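import Summits.FinalStateConjecture.FinalStateConjecture.Theorems.BartnikGapSettlingGapExhaustionLevelSweep
import Summits.FinalStateConjecture.FinalStateConjecture.Theorems.BartnikGapSettlingGapExhaustionKerrRadiusSublevelConvex
import Summits.FinalStateConjecture.FinalStateConjecture.Theorems.BartnikGapSettlingGapExhaustionKerrRadiusBandCover
import Summits.FinalStateConjecture.FinalStateConjecture.Theorems.BartnikGapSettlingGapExhaustionIsKillingFieldOnPatching
import HarnessLib

/-!
# Crux `GapExhaustion` (stmt-FinalStateConjecture-10808), line `photon-shell-pseudoconvexity`:
# stub (W2-A) `stub_kerrCoordKillingSweep` — the level-set sweep for COORDINATE KILLING FIELDS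
# of a metric datum across the Kerr–Schild cylinders `{r = c}`, `c ∈ [c₀, c₁]`

Route `BartnikGapSettling`; helper (`--supports stmt-FinalStateConjecture-10808`) of line lead c9
(§1g SWEEP, wave 2). The line's sweeps (S5 outward / S6b conditional) extend a Killing field
across the Kerr–Schild cylinders `{r = c}` by the Ionescu–Klainerman LOCAL extension theorem with
a uniform radius, patching the local extensions by unique continuation (Ionescu–Klainerman,
JAMS 26 (2013) Thm 1.2; globalisation as in Alexakis–Ionescu–Klainerman, CMP 299 (2010) §6).
This file instantiates the landed ABSTRACT level-set sweep `stub_levelSweep` (S-3) for coordinate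
Killing fields of a metric datum `G` on an open set `W ⊆ E4` (`MetricCoord.IsMetricOn G W`):
the admissibility predicate is

  `P k U :⇔ ∃ U' open, U ⊆ U' ⊆ W, k ∈ C²(U') and DG(y)(k y)(Y,Z) + G y (Dk Y) Z + G y Y (Dk Z) = 0
   on U'`

("`k` is a `C²` Killing field on some open superset of `U` inside `W`"). Its four axioms are:
restriction (same witness), locality on open sets (the Killing equation only sees the germ of
`k`: `fderiv` of eventually equal maps agree), gluing over open families (union of the
witnesses; `C²` is local on open sets), and unique continuation on connected open sets — the
§1e chain `stub_killingPatching_of ∘ stub_killingUniqueContinuation_of ∘ …` applied to the metric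
datum restricted to the connected open set. The three geometric inputs for the level function
`f = Kerr.radius a` are (S-1) `stub_kerrRadius_sublevel_convex` (convex sublevel sets) and (S-2)
`stub_kerrRadius_bandCover` (covering estimate with constant `C = 2`, and density
`{r ≤ c} ⊆ closure {r < c}`), valid for `0 < c₀ ≤ c`, `|a| ≤ c₀`. The output radius fed to the
abstract sweep is `min ρ' ρ`, so that the output balls `ball x (min ρ' ρ) ⊆ ball x ρ ⊆ D ⊆ W`
stay inside the domain of the metric datum. [folklore globalisation; cf.
Alexakis–Ionescu–Klainerman, CMP 299 (2010), §6]
-/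

noncomputable section

-- instance search through the nested operator types `E4 →L[ℝ] E4 →L[ℝ] E4 →L[ℝ] ℝ`
set_option maxSynthPendingDepth 3

-- D-0017: single-problem summit, `Summit.<S>.<S>.…` by design (cf. lakefile `weak.linter.dupNamespace`).
set_option linter.dupNamespace false

namespace Summit.FinalStateConjecture.FinalStateConjecture.Theorems

open Set Metric
open Literature.Geometry.Lorentzian Literature.Geometry.Lorentzian.MetricCoord
open scoped Topology ContDiff

/-- **Stub (W2-A) of the line `photon-shell-pseudoconvexity` (crux `GapExhaustion`,
stmt-FinalStateConjecture-10808) — the level-set sweep for coordinate Killing fields across the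
Kerr–Schild cylinders.** Let `G` be a metric datum on the open set `W ⊆ E4`, `D ⊆ W` an open
arena, `0 < c₀ ≤ c₁`, `|a| ≤ c₀`, `0 < ρ`, `0 < ρ'`, such that for every level `c ∈ [c₀, c₁]` and
every point `x` of the cylinder `{r = c}` (`r = Kerr.radius a`) the ball `ball x ρ` lies in `D`
and every `C²` Killing field of `G` on the inner half-ball `ball x ρ ∩ {r < c}` is extended by a
`C²` Killing field on `ball x ρ'` (the UNIFORM LOCAL EXTENSION property, Ionescu–Klainerman,
JAMS 26 (2013), Thm 1.2). Then every `C²` Killing field `k₀` of `G` on `D ∩ {r < c₀}` is extended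
by a `C²` Killing field on `D ∩ {r < c₁}`. Proof: the abstract level-set sweep `stub_levelSweep`
for the predicate "`C²` Killing on an open superset inside `W`", the level function
`Kerr.radius a` (convex sublevel sets (S-1), covering/density (S-2)), and output radius
`min ρ' ρ`. [folklore globalisation; cf. Alexakis–Ionescu–Klainerman, CMP 299 (2010), §6] -/
theorem stub_kerrCoordKillingSweep :
    ∀ (G : E4 → E4 →L[ℝ] E4 →L[ℝ] ℝ) (W D : Set E4) (a c₀ c₁ ρ ρ' : ℝ) (k₀ : E4 → E4),
      IsMetricOn G W → IsOpen D → D ⊆ W → c₀ ≤ c₁ → 0 < c₀ → |a| ≤ c₀ → 0 < ρ' → 0 < ρ →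
      (∀ c ∈ Icc c₀ c₁, ∀ x : E4, Kerr.radius a x = c → ball x ρ ⊆ D) →
      (∀ c ∈ Icc c₀ c₁, ∀ x : E4, Kerr.radius a x = c → ∀ k : E4 → E4,
        ContDiffOn ℝ 2 k (ball x ρ ∩ {y | Kerr.radius a y < c}) →
        (∀ y ∈ ball x ρ ∩ {y | Kerr.radius a y < c}, ∀ Y Z : E4,
          fderiv ℝ G y (k y) Y Z + G y (fderiv ℝ k y Y) Z + G y Y (fderiv ℝ k y Z) = 0) →
        ∃ k' : E4 → E4, ContDiffOn ℝ 2 k' (ball x ρ') ∧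
          (∀ y ∈ ball x ρ', ∀ Y Z : E4,
            fderiv ℝ G y (k' y) Y Z + G y (fderiv ℝ k' y Y) Z + G y Y (fderiv ℝ k' y Z) = 0) ∧
          EqOn k' k (ball x ρ' ∩ {y | Kerr.radius a y < c})) →
      ContDiffOn ℝ 2 k₀ (D ∩ {y | Kerr.radius a y < c₀}) →
      (∀ y ∈ D ∩ {y | Kerr.radius a y < c₀}, ∀ Y Z : E4,
        fderiv ℝ G y (k₀ y) Y Z + G y (fderiv ℝ k₀ y Y) Z + G y Y (fderiv ℝ k₀ y Z) = 0) →
      ∃ k : E4 → E4, ContDiffOn ℝ 2 k (D ∩ {y | Kerr.radius a y < c₁}) ∧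
        (∀ y ∈ D ∩ {y | Kerr.radius a y < c₁}, ∀ Y Z : E4,
          fderiv ℝ G y (k y) Y Z + G y (fderiv ℝ k y Y) Z + G y Y (fderiv ℝ k y Z) = 0) ∧
        EqOn k k₀ (D ∩ {y | Kerr.radius a y < c₀}) := by
  intro G W D a c₀ c₁ ρ ρ' k₀ hG hD hDW hc hc₀ ha hρ' hρ hball hloc hk₀ hkil₀
  -- the admissibility predicate: `C²` Killing field of `G` on some open superset inside `W`
  let P : (E4 → E4) → Set E4 → Prop := fun k U ↦ ∃ U' : Set E4, IsOpen U' ∧ U ⊆ U' ∧ U' ⊆ W ∧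
    ContDiffOn ℝ 2 k U' ∧ ∀ y ∈ U', ∀ Y Z : E4,
      fderiv ℝ G y (k y) Y Z + G y (fderiv ℝ k y Y) Z + G y Y (fderiv ℝ k y Z) = 0
  -- (restriction)
  have hmono : ∀ (k : E4 → E4) (U V : Set E4), P k U → V ⊆ U → P k V := by
    rintro k U V ⟨U', hU'o, hUU', hU'W, hk, hkil⟩ hVU
    exact ⟨U', hU'o, hVU.trans hUU', hU'W, hk, hkil⟩
  -- (locality on open sets)
  have hcongr : ∀ (k k' : E4 → E4) (U : Set E4), IsOpen U → EqOn k k' U → P k U → P k' U := by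
    rintro k k' U hU heq ⟨U', _, hUU', hU'W, hk, hkil⟩
    refine ⟨U, hU, Subset.rfl, hUU'.trans hU'W, (hk.mono hUU').congr fun y hy ↦ (heq hy).symm,
      fun y hy Y Z ↦ ?_⟩
    have hev : k' =ᶠ[𝓝 y] k := heq.symm.eventuallyEq_of_mem (hU.mem_nhds hy)
    rw [hev.fderiv_eq, hev.eq_of_nhds]
    exact hkil y (hUU' hy) Y Z
  -- (gluing over open families)
  have hunion : ∀ (k : E4 → E4) (ι : Type) (U : ι → Set E4), (∀ i, IsOpen (U i)) →
      (∀ i, P k (U i)) → P k (⋃ i, U i) := by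
    intro k ι U _ hP
    choose U' hU'o hUU' hU'W hk hkil using hP
    refine ⟨⋃ i, U' i, isOpen_iUnion hU'o, iUnion_mono hUU', iUnion_subset hU'W,
      fun y hy ↦ ?_, fun y hy Y Z ↦ ?_⟩
    · obtain ⟨i, hi⟩ := mem_iUnion.1 hy
      exact ((hk i).contDiffAt ((hU'o i).mem_nhds hi)).contDiffWithinAt
    · obtain ⟨i, hi⟩ := mem_iUnion.1 hy
      exact hkil i y hi Y Z
  -- (unique continuation on connected open sets: the §1e chain
  -- `stub_killingPatching_of ∘ stub_killingUniqueContinuation_of ∘ …` (O'Neill 1983, Ch. 9,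
  -- Lemma 9.28, local form) on the metric datum restricted to `V`, `KerrSchildChart.isMetricOn_mono`)
  have hpatch : ∀ (k₁ k₂ : E4 → E4) (U V : Set E4), IsOpen V → IsConnected V → IsOpen U →
      U ⊆ V → U.Nonempty → P k₁ V → P k₂ V → EqOn k₁ k₂ U → EqOn k₁ k₂ V := by
    rintro k₁ k₂ U V hV hVc hU hUV hUne ⟨V₁, _, hVV₁, hV₁W, hk₁, hkil₁⟩
      ⟨V₂, _, hVV₂, _, hk₂, hkil₂⟩ heq y hy
    exact stub_killingPatching_of
      (stub_killingUniqueContinuation_of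
        (stub_killingProlongation_of stub_killingHessianSkew stub_killingHessianAlt
          stub_curvatureLikeAlgebra)
        stub_firstOrderVanishing stub_killingJetBound_of)
      G V U k₁ k₂ (KerrSchildChart.isMetricOn_mono hG hV (hVV₁.trans hV₁W)) hVc hU hUV hUne
      (hk₁.mono hVV₁) (hk₂.mono hVV₂) (fun z hz ↦ hkil₁ z (hVV₁ hz)) (fun z hz ↦ hkil₂ z (hVV₂ hz))
      (fun _ hz ↦ heq hz) y hy
  -- geometry of the level function `r = Kerr.radius a`
  have hf : Continuous (Kerr.radius a) := Kerr.continuous_radius a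
  have hlt : ∀ c : ℝ, IsOpen {y : E4 | Kerr.radius a y < c} := fun c ↦
    isOpen_lt hf continuous_const
  have hconv : ∀ c ∈ Icc c₀ c₁, Convex ℝ {x : E4 | Kerr.radius a x ≤ c} := fun c hc ↦
    (stub_kerrRadius_sublevel_convex a c (hc₀.trans_le hc.1)).2
  have hdense : ∀ c ∈ Icc c₀ c₁,
      {x : E4 | Kerr.radius a x ≤ c} ⊆ closure {x : E4 | Kerr.radius a x < c} := fun c hc ↦
    (stub_kerrRadius_bandCover a c (hc₀.trans_le hc.1) (ha.trans hc.1)).2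
  have hcover : ∀ c ∈ Icc c₀ c₁, ∀ y ∈ D, c ≤ Kerr.radius a y →
      ∃ x : E4, Kerr.radius a x = c ∧ ‖x - y‖ ≤ 2 * (Kerr.radius a y - c) := by
    intro c hc y _ hy
    obtain ⟨x, hx, -, hxy⟩ :=
      (stub_kerrRadius_bandCover a c (hc₀.trans_le hc.1) (ha.trans hc.1)).1 y hy
    exact ⟨x, hx, hxy⟩
  -- the output radius `ρ₁ = min ρ' ρ`, so that the output balls stay inside `D ⊆ W`
  set ρ₁ : ℝ := min ρ' ρ with hρ₁def
  have hρ₁ : 0 < ρ₁ := lt_min hρ' hρ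
  have hloc' : ∀ c ∈ Icc c₀ c₁, ∀ x : E4, Kerr.radius a x = c → ∀ k : E4 → E4,
      P k (ball x ρ ∩ {y | Kerr.radius a y < c}) →
      ∃ k' : E4 → E4, P k' (ball x ρ₁) ∧ EqOn k' k (ball x ρ₁ ∩ {y | Kerr.radius a y < c}) := by
    rintro c hc x hx k ⟨U', _, hsub, _, hk, hkil⟩
    obtain ⟨k', hk', hkil', heq⟩ :=
      hloc c hc x hx k (hk.mono hsub) fun y hy ↦ hkil y (hsub hy)
    have h₁ : ball x ρ₁ ⊆ ball x ρ' := ball_subset_ball (min_le_left _ _)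
    have h₂ : ball x ρ₁ ⊆ ball x ρ := ball_subset_ball (min_le_right _ _)
    exact ⟨k', ⟨ball x ρ₁, isOpen_ball, Subset.rfl, h₂.trans ((hball c hc x hx).trans hDW),
      hk'.mono h₁, fun y hy ↦ hkil' y (h₁ hy)⟩,
      heq.mono (inter_subset_inter_left _ h₁)⟩
  -- the initial field
  have hP₀ : P k₀ (D ∩ {y | Kerr.radius a y < c₀}) :=
    ⟨D ∩ {y | Kerr.radius a y < c₀}, hD.inter (hlt c₀), Subset.rfl, inter_subset_left.trans hDW,
      hk₀, hkil₀⟩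
  -- sweep
  obtain ⟨k, ⟨U', _, hsub, _, hk, hkil⟩, heq⟩ :=
    stub_levelSweep E4 P (Kerr.radius a) D c₀ c₁ ρ ρ₁ 2 k₀ hmono hcongr hunion hpatch hf hD hc
      hρ₁ two_pos hconv hdense hcover hball hloc' hP₀
  exact ⟨k, hk.mono hsub, fun y hy ↦ hkil y (hsub hy), heq⟩

end Summit.FinalStateConjecture.FinalStateConjecture.Theorems

end
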